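import Mathlib
import HarnessLib
import HarnessLib.Audit
import Summits.AnomalousDissipation.Statement
import HarnessLib.Audit.Status.Attr

/-!
Route: LandauJetArena

DORMANT since 2026-08-22T05:37:54Z (reconciler: no traction for 5.1 d (last activity item-evidence-added at 2026-08-17T02:34:09Z); parked, not closed — `ledger route dormant route-AnomalousDissipation-LandauJetArena --off` to reactivate) — unstaffed, not closed; items shared with open routes are served there. `ledger route dormant <id> --off` reactivates.

# Route LandauJetArena — AnomalousDissipation (Literature.Turb.ZerothLaw); realises idea card
landau-jet-arena-conical-similarity

## Thesis X (words)
The zeroth law is carried by JETS. Put on T³ a PUSH–PULL JET PAIR: f = P[(φ(x−a) − φ(x+a)) e₃], the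
Leray
projection of two opposite unit point-momentum sources mollified at radius ρ (φ ≥ 0 smooth, supp φ ⊂
B_ρ(0),
∫φ = 1, 4ρ < dist(a,−a)); f is smooth, divergence-free, mean-zero, steady and ν-independent. X: for
SOME such
jet-pair force there is a vanishing-viscosity family of global Leray–Hopf solutions with bounded
limsup-mean
energy and limsup-mean dissipation ν_j⟨‖∇u_j‖²⟩ ≥ ε > 0. Each source drives a submerged round jet
whose
near field (ρ ≪ |x∓a| ≪ 1) is the scale-free POINT-FORCE ARENA on ℝ³ (force bδ₀e₃ is NS-critical,
degree −3):
there ν → 0 ⇔ Re = b^{1/2}/ν → ∞ ⇔ "look at the same cone", the laminar Landau needle has BOUNDED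
shell energy
but shell dissipation ≍ b²/ν → ∞ (it violates the zeroth law upward), no steady self-similar
non-Landau state
exists (Šverák 2011) and no C¹ (−1)-homogeneous steady Euler cone exists (Shvydkoy 2018 Prop. 2.1):
the
turbulent jet's Re-independent opening angle IS the zeroth law of this arena.

## Thesis X (Lean, one line; elaborates rc 0 in Sketch.lean, decl JetPairZerothLaw)
∃ ρ a φ f, JetPair(ρ,a,φ,f) ∧ ∃ ν u₀ u, (∀ j, 0 < ν j) ∧ Tendsto ν atTop (𝓝 0) ∧ (∀ j,
Torus.IsGlobalLerayHopf (ν j) (fun _ => f) (u₀ j) (u j))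
∧ (∃ E, ∀ j, meanEnergy (u j) ≤ E) ∧ ∃ ε > 0, ∀ j, ε ≤ meanDissipation (ν j) (u j),
where JetPair(ρ,a,φ,f) := 0 < ρ ∧ 4ρ < ‖a + a‖ ∧ Torus.IsSmooth φ ∧ φ ≥ 0 ∧ (‖x‖ ≥ ρ → φ x = 0) ∧ ∫φ
= 1 ∧ Torus.IsSmooth f ∧
Torus.IsDivFree f ∧ Torus.HasZeroMean f ∧ ∀ w smooth div-free, ∫⟪f,w⟫ = ∫ (φ(x−a) − φ(x+a))·w₃   (f
= Leray projection, no projector needed).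
All constants exist (lean search --decl): UnitAddTorus,
Literature.Analysis.FunctionSpaces.Torus.IsSmooth/IsDivFree/HasZeroMean,
Literature.Analysis.FluidPDE.Torus.IsGlobalLerayHopf,
Literature.Analysis.FluidPDE.meanEnergy/meanDissipation/longTimeAvgSup,
Literature.Analysis.FluidPDE.IsGlobalLerayHopf/HasWeakGradient/frobeniusNormSq/IsWeaklyDivFree
(whole-space arena), AnomalousDissipation.

## Assembly X → AnomalousDissipation
Drop the jet-pair clauses (the class definition contains IsSmooth f, IsDivFree f, HasZeroMean f);
4-line term proof checked in Sketch.lean.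
The cruxes give X by the support glue FloorAndFamilyGiveTarget (reindex the bounded-energy family
past ν₀(E), apply the floor).

Rationale: WHY THIS LINE (physical analogy WITH an explicit dictionary; rigidity/classification imported from
steady homogeneous NS/Euler theory).
Dictionary: ν → 0 at fixed force ↔ Re = b^{1/2}/ν → ∞ in the scale-free point-force arena (f = bδ₀e₃
has the NS-critical degree −3);
box averages ↔ shell functionals on A = {1<|x|<2} (E_A = ⟨∫_A|u|²⟩, D_A = ν⟨∫_A|∇u|²⟩, energy flux
P(r) ∝ 1/r, D_A = P(1) − P(2));
ε = O(U³/ℓ) ↔ D_A ≍ b^{3/2} ↔ ν-uniform opening angle θ_* > 0 of the turbulent jet (momentum flux b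
through every sphere is exact).
Three exact facts make this the geometry with the most structure: (L) Landau 1944 / Squire 1951
explicit needle U_{b,ν} (Karch–Pilarczyk
arXiv:1104.3589 (2.1)–(2.2): b(c) → ∞ as c → 1⁺): E_A ≍ b bounded while D_A ≍ b²/ν → ∞ — the laminar
state satisfies the energy
clause and violates the zeroth law UPWARD (item LandauOverDissipation, typed); (S) Šverák 2011
(arXiv:math/0604550): every smooth
(−1)-homogeneous steady NS field on ℝ³∖{0} is Landau ⇒ a non-laminar self-similar state is
necessarily unsteady/statistical;
(E) Shvydkoy 2018 (arXiv:1510.03378 Prop. 2.1, §5.1 read): no C¹ (−1)-homogeneous steady Euler cone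
⇒ the quiet inviscid conical
"dodger" a dissipationless limit would need is absent among C¹ cones (item NoConicalEulerFlux
extends this to C⁰ cones with flux).
Transfer to T³ is by the push–pull pair (thesis): zooming at a source by ρ keeps b AND ν
(criticality) and sends the box flow
U_box·ρ → 0, so the near field is the arena; the far field re-enters only through the energy clause
(crux 4).
SHARPENING vs the card (recorded so refuters need not rediscover it): with axisymmetric force and
ZERO (or axisymmetric swirl-free)
data the Leray–Hopf solution on ℝ³ is unique, global, smooth and axisymmetric-without-swirl
(Ladyzhenskaya 1968, Ukhovskii–Yudovich
1968; in tree Literature.Analysis.FluidPDE.axisymmetric_no_swirl_global_regularity +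
weak_strong_uniqueness), a 2-D-like class without
vortex stretching in which the far jet is linearly STABLE to axisymmetric modes (Batchelor–Gill 1962
doi:10.1017/s0022112062001421:
only the helical m=1 mode is unstable) and, at small flux, the needle attracts ALL L² perturbations
(Karch–Pilarczyk Thm 2.1, |c| ≥ c₀).
Hence the card's ∀-solution forms of J3/J4 are false-or-2D in that class; every arena statement here
is EXISTENTIAL in the data
(symmetry breaking is part of the witness), exactly like the summit.
RANKED CRUXES. r2 JetPairDissipationFloor (T³; ∀ jet-pair f ∀E ∃ε,ν₀: every global LH solution with
meanEnergy ≤ E and ν ≤ ν₀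
has meanDissipation ≥ ε) — "no bounded-energy dodger for a jet pair" = card J4 in T³ clothes;
hardest, a level statement.
r3 JetShellLawWholeSpace (ℝ³ arena, the jet zeroth law proper: ∃ c₁,c₂,c₃ uniform in ρ ≤ ρ₀, ν ≤ ν₀,
for every admissible bump,
SOME finite-energy datum and global LH solution with force φ_ρ e₃ has c₁ ≤ D_A ≤ c₂ and E_A ≤ c₃) —
two-sided: ceiling = entrainment
floor (no collapse onto the needle, card J3), floor = no conical dodger (J4); most informative,
refutable by computation.
r4 JetPairBoundedEnergyFamily (T³; ∃ jet-pair config with a bounded-energy LH family ν_j → 0) —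
entrainment ceiling + far-field
recirculation (card J3+J5); implies Correlation.BoundedEnergyFamily; the summit's energy clause for
this f.
Support (rank 9): FloorAndFamilyGiveTarget (glue, provable now); JetPairForceExists (P of the
monopole pair is smooth: torus Fourier);
NoConicalEulerFlux (C⁰ (−1)-homogeneous steady weak Euler cones carry zero momentum flux; adapt
Shvydkoy §2); LandauOverDissipation
(explicit real analysis on Karch–Pilarczyk's formula: ∫_A|v_c|² ≤ C₂ b(c), ∫_A|∇v_c|² ≥ C₁ b(c)² on
(1,2)).
KILL CRITERIA. JetShellLawWholeSpace refuted from ABOVE (every LH solution, all data, hugs the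
needle: D_A/b^{3/2} → ∞) or from BELOW
(D_A → 0 / E_A → ∞ for all data) closes the route (the mechanism is dead even if T³ items stay
open). JetPairDissipationFloor refuted by
an explicit bounded-energy dodger closes it and is a ¬ZerothLaw-type landmark.
JetPairBoundedEnergyFamily refuted alone ⇒ pivot to the
arena theorem only (route value = near-field law + rigidity package). NoConicalEulerFlux refuted by
a C⁰ flux-carrying cone ⇒ restate r2's
engine over L²(S²)-cones with finite shell energy or drop the rigidity rationale.
NOT DECOMPOSED YET: conical self-similarity of statistics (needs a dilation-invariant Banach mean in
log r — refuter caveat (a), conceded);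
the zoom/compactness lemma "T³ near field ⇒ arena statistics"; rates (Batchelor–Gill growth) vs
levels (cycling loophole, conceded);
singular/statistical cone rigidity beyond C⁰; which (a,ρ) — coaxial antipodal a = (0,0,1/4) (jets
fired at each other, no re-entry of a
jet into its own source) is the recommended witness configuration for r4.
Definition request: landauSolution (Literature/Analysis/FluidPDE), for the Šverák/Karch–Pilarczyk
facts. Cite facts requested: Sverak2011
classification; Shvydkoy2018 Prop 2.1.

Novelty: NOVELTY (plancard planner 2026-08-15; searches run BEFORE this claim — lit searchd/galaxy were DOWN
(exit 75 / conn reset) and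
OpenAlex/arXiv APIs rate-limited (HTTP 429) during this pass, so the remote cascade ran on zbMATH:
"Sverak Landau solutions
Navier-Stokes" (→ doi:10.1007/s10958-011-0590-5 = arXiv:math/0604550; Korolev–Šverák
arXiv:0711.0560; Jia–Šverák arXiv:2605.24200),
"Shvydkoy homogeneous solutions Euler" (→ arXiv:1510.03378 = doi:10.1090/tran/7022, READ pp.3,5,12:
Prop. 2.1 'no C¹-solutions for
α = 1', §5.1 'the only way to restore solutions to Euler via vanishing viscosity limit is through a
sequence of singular solutions';
Luo–Shvydkoy arXiv:1409.4322, arXiv:1608.00061 (2-D); Abe arXiv:2305.05987 existence for degrees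
outside [−2,0]), "asymptotic
stability Landau solutions" (→ Karch–Pilarczyk arXiv:1104.3589 READ pp.2–5: global L²-asymptotic
stability for |c| ≥ c₀, i.e. SMALL
flux; Li–Zhang–Zhang arXiv:2012.14211; Li–Yan arXiv:1911.03002; Zhang–Zhang
doi:10.3934/era.2021010), "conically similar viscous
flows" (→ Goldshtik–Shtern doi:10.1017/s0022112090001082 collapse/loss of existence at finite Re;
Paull–Pillow 1985 I–III;
Fernandez-Feria et al doi:10.1093/qjmam/52.1.1; Stein 2000/2001), "Landau solutions Navier-Stokes
perturbations" (→ Shtern–Drazin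
doi:10.1098/rspa.2000.0555), "Batchelor Gill stability axisymmetric jets" (→
doi:10.1017/s0022112062001421), "turbulent round jet
similarity Reynolds number" (→ Ewing–George doi:10.1017/s0022112006004538; Bogey–Ba  [refs: 10.1007/s10958-011-0590-5, 10.1090/tran/7022, 10.3934/era.2021010, 10.1017/s0022112090001082, 10.1093/qjmam/52.1.1, 10.1098/rspa.2000.0555, 10.1017/s0022112062001421, 10.1017/s0022112006004538, 10.1017/s0022112009005801, 10.1017/jfm.2024.161, 10.1017/s002211209400323x, math/0604550, 0711.0560, 2605.24200, 1510.03378, 1409.4322, 1608.00061, 2305.05987, 1104.3589, 2012.14211, 1911.03002, doi:10.1007]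

Barriers (technique_class: scale-invariant-forcing-arena homogeneous-solution-rigidity): Literature.Barriers.AnomalousDissipation.DeRosaDrivasInversi2024_thm19_bounded: APPLIES to finite
windows of the T³ witnesses (f_ρ smooth; jet speeds ≍ ρ⁻¹ near the sources but nothing forces
unbounded velocity a priori): for uniformly bounded families the limiting dissipation measure is ≪
H³ in space–time, so it cannot sit on the two jet AXES or at the sources alone; consistent — the
thesis asserts space-filling dissipation inside turbulent cones (γ = d locally); in the singular
arena (force bδ₀e₃, |u| ≍ r⁻¹) the bounded-field hypothesis fails near the origin and the barrier is
silent there. (Companions DeRosaIsett2024_thm213 and DeRosaDrivasInversiIsett2025_cor51 in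
IntermittentDissipation.lean: likewise consistent — no witness with dissipation on a set of
dimension < 3 is proposed; the Landau needle, dissipating in a cone of angle ≍ ν b^{-1/2}, is the
LAMINAR state the cruxes exclude, not a witness.)
Literature.Barriers.AnomalousDissipation.DeRosaDrivasInversi2024_thm12_bounded: same content for a
given bounded Euler limit; unforced, never instantiates on a (forced) witness window; respected as
above.
Literature.Barriers.AnomalousDissipation.BrueDeLellis2023_noAnomaly_beforeEulerSingularity: evaded
by the summit's own long-time-average form used verbatim (limsup means of global LH solutions, t → ∞
before ν → 0), its listed evasion; additionally the arena force bδ₀e₃ admits no classical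
forced-Euler solution to converge to (Shvydkoy 2018 Prop. 2.1 is the steady shadow). (Sa

History (route lifecycle, newest last):
- 2026-08-16T03:42:02Z · AUTO-CRUX (backfill): JetPairZerothLaw — hypotheses of the deciding theorem that nothing in the route derives are cruxes (operator:999:586464)
- 2026-08-22T05:37:54Z · DORMANT — reconciler: no traction for 5.1 d (last activity item-evidence-added at 2026-08-17T02:34:09Z); parked, not closed — `ledger route dormant route-AnomalousDissipa (operator:999:4004251)

sub-problem: AnomalousDissipation · status: dormant · opened planner-plancard-AnomalousDissipation-Anomalo-bcc6242d-0 2026-08-15T10:57:21Z · rev 2 · ledger route-AnomalousDissipation-LandauJetArena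
GENERATED by the gate from the ledger (D-0016/17). Provers cite these decls: `theorem foo : Summit.AnomalousDissipation.AnomalousDissipation.Theses.LandauJetArena.<Decl> := …` in Summits/AnomalousDissipation/AnomalousDissipation/Theorems/<Name>.lean.
-/

namespace Summit.AnomalousDissipation.AnomalousDissipation.Theses.LandauJetArena

open scoped BigOperators Topology Manifold Classical MeasureTheory ProbabilityTheory Matrix InnerProductSpace ComplexConjugate ContinuousMap
open Filter Set Function TopologicalSpace MeasureTheory

attribute [summit_statement] _root_.AnomalousDissipation

open Literature.Turb

/-- item stmt-AnomalousDissipation-1540 · crux (kind.auto-crux: conjecture-grade) · rank 0 · open · by planner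
why it might fail: Needs BOTH a nu-uniform energy bound for a fixed localized 3-D force (none known for any f != 0; a priori |f|^2/(nu lambda1)^2 only, FMRT (13.11)) AND a dissipation floor along the same family; 2-D analogue false (AlexakisDoering2006); no fixed-force example in print (Cheskidov2023 p.4).
sources: BrueDeLellis2023 = arXiv:2207.06301 p.5 Questions 2.1-2.2 (fixed / steady force: open), Cheskidov2023 = arXiv:2311.04182 sec. 1.2 p.4 ('no known example' at fixed force), Thm 1.3 (nu-dependent forces), Landau-Lifshitz, Fluid Mechanics sec. 23 (Landau jet) and sec. 36 (turbulent jet: Re-independent angle, speed ~ b^(1/2)/r), HusseinCappGeorge1994 doi:10.1017/s002211209400323x (momentum-conserving round-jet similarity, Re-independence), Literature.Barriers.AnomalousDissipation.AlexakisDoering2006_energyDissipationBound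
[target] X: ZerothLaw restricted to PUSH-PULL JET-PAIR forces on T^3. JetPair(rho,a,phi,f) := 0<rho,
4rho<||a+a|| (= dist(a,-a): blobs disjoint, a != -a), phi smooth >= 0 supported in B_rho(0) with
integral 1 (unit momentum flux b = 1, WLOG since nu -> 0 sweeps Re = b^(1/2)/nu), f smooth div-free
mean-zero with int<f,w> = int (phi(x-a)-phi(x+a)) w_3 for all smooth div-free w (i.e. f = Leray
projection of the monopole pair (phi(.-a)-phi(.+a))e3, stated without a projector; pins f uniquely).
X := exists (rho,a,phi,f) in the class and a vanishing-viscosity family of global Leray-Hopf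
solutions with bounded limsup-mean energy and limsup-mean dissipation >= eps > 0 (same
conventions/constants as Literature.Turb.ZerothLaw). Follows from cruxes r2 + r4 by the glue
FloorAndFamilyGiveTarget. Recommended witness geometry: coaxial antipodal a = (0,0,1/4) (the two
jets are fired AT each other through x3 in (1/4,3/4) and entrain from (-1/4,1/4); no jet re-enters
its own source). -/
@[route_item "route-AnomalousDissipation-LandauJetArena", crux]
def JetPairZerothLaw : Prop :=
  ∃ (ρ : ℝ) (a : UnitAddTorus (Fin 3)) (φ : UnitAddTorus (Fin 3) → ℝ) (f : UnitAddTorus (Fin 3) → EuclideanSpace ℝ (Fin 3)), (0 < ρ ∧ 4 * ρ < ‖a + a‖ ∧ Literature.Analysis.FunctionSpaces.Torus.IsSmooth φ ∧ (∀ x, 0 ≤ φ x) ∧ (∀ x : UnitAddTorus (Fin 3), ρ ≤ ‖x‖ → φ x = 0) ∧ MeasureTheory.integral MeasureTheory.volume (fun x => φ x) = 1 ∧ Literature.Analysis.FunctionSpaces.Torus.IsSmooth f ∧ Literature.Analysis.FunctionSpaces.Torus.IsDivFree f ∧ Literature.Analysis.FunctionSpaces.Torus.HasZeroMean f ∧ (∀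 w : UnitAddTorus (Fin 3) → EuclideanSpace ℝ (Fin 3), Literature.Analysis.FunctionSpaces.Torus.IsSmooth w → Literature.Analysis.FunctionSpaces.Torus.IsDivFree w → MeasureTheory.integral MeasureTheory.volume (fun x => inner ℝ (f x) (w x)) = MeasureTheory.integral MeasureTheory.volume (fun x => (φ (x - a) - φ (x + a)) * inner ℝ (w x) (EuclideanSpace.single (2 : Fin 3) (1 : ℝ) : EuclideanSpace ℝ (Fin 3))))) ∧ ∃ (ν : ℕ → ℝ) (u₀ : ℕ → UnitAddTorus (Fin 3) → EuclideanSpace ℝ (Fin 3)) (u : ℕ → ℝ → UnitAddTorus (Fin 3) → EuclideanSpace ℝ (Fin 3)), (∀ j, 0 < ν j) ∧ Filter.Tendsto ν Filter.atTop (nhds 0) ∧ (∀ j, Literature.Analysis.FluidPDE.Torus.IsGlobalLerayHopf (ν j) (fun _ => f) (u₀ j) (u j)) ∧ (∃ E : ℝ, ∀ j, Literature.Analysis.FluidPDE.meanEnergy (u j) ≤ E) ∧ ∃ ε : ℝ, 0 < ε ∧ ∀ j, ε ≤ Literature.Analysis.FluidPDE.meanDissipation (ν j) (u j)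

/-- item stmt-AnomalousDissipation-1542 · crux · rank 2 · open · by planner
why it might fail: 'All data, all E' admits a Galilean-drift dodger: m = mean(u0) is conserved, |m|^2 < E; u = M V(x,Mt) makes f an eps = 1/M^2 force on Euler near the constant Diophantine field m/M; phi even => f odd => Baldi-Montalto Thm 1.1: bounded non-dissipating states; a nu-uniform 3-D continuation refutes it.
sources: BaldiMontalto2021 = arXiv:2003.14313 (doi:10.1016/j.aim.2021.107730) Thm 1.1, pp.1-2 read: QP Euler states on T^3 = eps-perturbations of constant Diophantine fields zeta, force eps*f odd in (phi,x), (omega,zeta) of asymptotically full measure; steady odd f(x) = the phi-independent case, FranzoiMontalto2024 = arXiv:2207.11008 (doi:10.1007/s00023-023-01408-9) Thm 1.2 + Remark 2, p.4 read: 2-D NS QP solutions -> the Baldi-Montalto Euler state uniformly in time as nu -> 0, force independent of nu (bounded energy, vanishing dissipation); 3-D analogue not in zbMATH as of 2026-08-15, Montalto2021 = arXiv:2005.13354 (doi:10.1007/s10884-021-09944-w): NS with time-QP force at fixed nu, any dimension, Literature.Analysis.FluidPDE.Torus.IsWeakNSSolutionForcedOn (WeakSolution.lean: 'Mean zero is not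 imposed'): constant test fields give conservation of the mean, meanEnergy >= |m|^2, Shvydkoy2018 = arXiv:1510.03378 Prop. 2.1 p.5 (no C^1 (-1)-homogeneous steady Euler), sec. 5.1 p.12, Cheskidov2023 = arXiv:2311.04182 Thm 1.3 / Literature.Barriers.AnomalousDissipation.Cheskidov2023_thm13_not_forceRobustNoAnomaly (what an energy-method refuter may not do)
[crux] r2 (hardest): NO BOUNDED-ENERGY DODGER FOR A JET PAIR. For every jet-pair force (any rho, a,
phi in the class) and every energy level E there are eps > 0 and nu0 > 0 such that EVERY global
Leray-Hopf solution (any finite-energy datum) with viscosity nu <= nu0, force f and limsup-mean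
energy <= E has limsup-mean dissipation nu<||grad u||^2> >= eps. Card J4 ('no conical dodger', lower
bound c1) in T^3 clothes: by the LH energy inequality dissipation <= mean work = <phi-averaged u_3
at a> - <... at -a>; each source of size rho pushed through at transit speed W creates a local
excess ~ 1/(rho^2 W), so failure needs a sustained fast stream through a rho-blob doing almost no
work - an (unsteady) Euler-like state absorbing a genuinely 3-D localized force. Intended engine:
zoom at the source by rho (keeps b and nu: criticality; kills the box flow, U_box*rho -> 0), weak-*
limits of stationary statistics are conical forced-Euler statistics carrying momentum flux 1 through
every small sphere, and conical dodgers are excluded by rigidity (NoConicalEulerFlux and its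
L^2(S^2)/statistical extensions). eps may depend on E and on the configuration; nu0 likewise. -/
@[route_item "route-AnomalousDissipation-LandauJetArena"]
def JetPairDissipationFloor : Prop :=
  ∀ (ρ : ℝ) (a : UnitAddTorus (Fin 3)) (φ : UnitAddTorus (Fin 3) → ℝ) (f : UnitAddTorus (Fin 3) → EuclideanSpace ℝ (Fin 3)), (0 < ρ ∧ 4 * ρ < ‖a + a‖ ∧ Literature.Analysis.FunctionSpaces.Torus.IsSmooth φ ∧ (∀ x, 0 ≤ φ x) ∧ (∀ x : UnitAddTorus (Fin 3), ρ ≤ ‖x‖ → φ x = 0) ∧ MeasureTheory.integral MeasureTheory.volume (fun x => φ x) = 1 ∧ Literature.Analysis.FunctionSpaces.Torus.IsSmooth f ∧ Literature.Analysis.FunctionSpaces.Torus.IsDivFree f ∧ Literature.Analysis.FunctionSpaces.Torus.HasZeroMean f ∧ (∀ w : UnitAddTorus (Fin 3) → EuclideanSpace ℝ (Fin 3), Literature.Analysis.FunctionSpaces.Torus.IsSmooth w → Literature.Analysis.FunctionSpaces.Torus.IsDivFree w → MeasureTheory.integral MeasureTheory.volume (fun x => inner ℝ (f x) (w x)) =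 MeasureTheory.integral MeasureTheory.volume (fun x => (φ (x - a) - φ (x + a)) * inner ℝ (w x) (EuclideanSpace.single (2 : Fin 3) (1 : ℝ) : EuclideanSpace ℝ (Fin 3))))) → ∀ E : ℝ, ∃ ε : ℝ, 0 < ε ∧ ∃ ν₀ : ℝ, 0 < ν₀ ∧ ∀ (ν : ℝ) (u₀ : UnitAddTorus (Fin 3) → EuclideanSpace ℝ (Fin 3)) (u : ℝ → UnitAddTorus (Fin 3) → EuclideanSpace ℝ (Fin 3)), 0 < ν → ν ≤ ν₀ → Literature.Analysis.FluidPDE.Torus.IsGlobalLerayHopf ν (fun _ => f) u₀ u → Literature.Analysis.FluidPDE.meanEnergy u ≤ E → ε ≤ Literature.Analysis.FluidPDE.meanDissipation ν u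

/-- item stmt-AnomalousDissipation-1543 · crux · rank 3 · open · by planner
why it might fail: Above: at small flux the needle attracts every L^2 perturbation (Karch-Pilarczyk Thm 2.1-2.2, |c|>c0); if its basin stays global at all Re, D_A ~ b^2/nu -> infinity for ALL data, so no c2. Below: quiet or energy-radiating states (ring puffing carrying flux to infinity) give D_A -> 0 at bounded E_A.
sources: KarchPilarczyk2011 = arXiv:1104.3589 (doi:10.1007/s00205-011-0409-z) Thm 2.1 (weak solutions v_c + w, w0 in L^2_sigma, |c| > c0) and Thm 2.2 (||w(t)||_2 -> 0), p.5 of the materialised text read 2026-08-15, LiZhangZhang2023 = arXiv:2012.14211 (L^p perturbations of Landau solutions); LiYan2021 = arXiv:1911.03002, BatchelorGill1962 doi:10.1017/s0022112062001421 (far round jet: only helical m=1 unstable), HusseinCappGeorge1994 doi:10.1017/s002211209400323x; BogeyBailly2009 doi:10.1017/s0022112009005801; Kewalramani et al 2024 doi:10.1017/jfm.2024.161 (Re-independent spreading/dissipation of the round jet: experiment/LES only), GoldshtikShtern1990 doi:10.1017/s0022112090001082 (collapse/bifurcation of conically similar viscous flows at finite Re), Sverak2011 = arXiv:math/0604550 (smooth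 (-1)-homogeneous steady NS on R^3 minus 0 = Landau)
[crux] r3: THE JET ZEROTH LAW IN THE WHOLE-SPACE ARENA (two-sided, EXISTENTIAL in the data). There
are c1 > 0, c2, c3 and rho0, nu0 > 0 such that for every source radius rho <= rho0, every viscosity
nu <= nu0 and every admissible bump phi (smooth, >= 0, supp in closedBall 0 rho, integral 1; force
phi(x) e3, unit momentum flux, Re = 1/nu) SOME finite-energy weakly div-free datum u0 and SOME
global Leray-Hopf solution u on R^3 (Literature.Analysis.FluidPDE.IsGlobalLerayHopf, weak gradient G
a.e. in t > 0) satisfy, on the shell A = {1 < |x| < 2}: c1 <= limsup-mean nu int_A |G|^2 <= c2 and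
limsup-mean int_A |u|^2 <= c3. Ceiling c2 (+ c3) = ENTRAINMENT FLOOR: the turbulent jet keeps a
nu-uniform opening angle, it cannot collapse onto the Landau needle (which has E_A ~ b bounded but
D_A ~ b^2/nu, item LandauOverDissipation) - card J3. Floor c1 = NO CONICAL DODGER - card J4.
Uniformity in rho <= rho0 = existence of the point-source limit (virtual origin); the order
'constants, then rho, nu' is deliberate. Existential in (u0,u) ON PURPOSE: with zero or axisymmetric
swirl-free data the LH solution is the unique global smooth axisymmetric-no-swirl flow
(Ladyzhenskaya 1968 / Ukhovskii-Yudovic -/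
@[route_item "route-AnomalousDissipation-LandauJetArena"]
def JetShellLawWholeSpace : Prop :=
  ∃ c₁ c₂ c₃ ρ₀ ν₀ : ℝ, 0 < c₁ ∧ 0 < ρ₀ ∧ 0 < ν₀ ∧ ∀ (ρ ν : ℝ) (φ : EuclideanSpace ℝ (Fin 3) → ℝ), 0 < ρ → ρ ≤ ρ₀ → 0 < ν → ν ≤ ν₀ → ContDiff ℝ (⊤ : ℕ∞) φ → (∀ x, 0 ≤ φ x) → (∀ x : EuclideanSpace ℝ (Fin 3), ρ ≤ ‖x‖ → φ x = 0) → MeasureTheory.integral MeasureTheory.volume (fun x => φ x) = 1 → ∃ (u₀ : EuclideanSpace ℝ (Fin 3) → EuclideanSpace ℝ (Fin 3)) (u : ℝ → EuclideanSpace ℝ (Fin 3) → EuclideanSpace ℝ (Fin 3)) (G : ℝ → EuclideanSpace ℝ (Fin 3) → EuclideanSpace ℝ (Fin 3) →L[ℝ] EuclideanSpace ℝ (Fin 3)), MeasureTheory.MemLp u₀ 2 MeasureTheory.volume ∧ Literature.Analysis.FluidPDE.IsWeaklyDivFree u₀ ∧ Literature.Analysis.FluidPDE.IsGlobalLerayHopf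 ν (fun (_ : ℝ) (x : EuclideanSpace ℝ (Fin 3)) => φ x • (EuclideanSpace.single (2 : Fin 3) (1 : ℝ) : EuclideanSpace ℝ (Fin 3))) u₀ u ∧ (∀ᵐ t ∂(MeasureTheory.volume.restrict (Set.Ioi (0 : ℝ))), Literature.Analysis.FluidPDE.HasWeakGradient (u t) (G t)) ∧ c₁ ≤ Literature.Analysis.FluidPDE.longTimeAvgSup (fun t => ν * MeasureTheory.integral (MeasureTheory.volume.restrict {x : EuclideanSpace ℝ (Fin 3) | 1 < ‖x‖ ∧ ‖x‖ < 2}) (fun x => Literature.Analysis.FluidPDE.frobeniusNormSq (G t x))) ∧ Literature.Analysis.FluidPDE.longTimeAvgSup (fun t => ν * MeasureTheory.integral (MeasureTheory.volume.restrict {x : EuclideanSpace ℝ (Fin 3) | 1 < ‖x‖ ∧ ‖x‖ < 2}) (fun x => Literature.Analysis.FluidPDE.frobeniusNormSq (G t x))) ≤ c₂ ∧ Literature.Analysis.FluidPDE.longTimeAvgSup (fun t => MeasureTheory.integral (MeasureTheory.volume.restrict {x : EuclideanSpace ℝ (Fin 3) | 1 < ‖x‖ ∧ ‖x‖ < 2})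 (fun x => ‖u t x‖ ^ 2)) ≤ c₃

/-- item stmt-AnomalousDissipation-1544 · crux · rank 4 · open · by planner
why it might fail: No nu-uniform mean-energy bound is known for ANY fixed f != 0 in 3-D (a priori |f|^2/(nu lambda1)^2 only, FMRT (13.11)); colliding jets on T^3 may feed a box-scale circulation that saturates only viscously (condensate analogue), so <|u|^2> -> infinity along every family driven by this f.
sources: FoiasManleyRosaTemam2001 (13.10)-(13.11) p.105 (laminar-type a priori bound ~ nu^-2), (12.44) p.102, DoeringFoias2002 sec. 3 (turbulent saturation Re ~ Gr^(1/2) vs laminar Re ~ Gr), Cheskidov2023 = arXiv:2311.04182 sec. 1.2 p.4 ('the diameter of the weak global attractor in L^2 in general grows as the viscosity goes to zero'; no fixed-force example known), stmt-AnomalousDissipation-0203 Correlation.BoundedEnergyFamily (implied by this item), FranzoiMontalto2024 = arXiv:2207.11008 Thm 1.2 (the only nu-uniform bounded forced family in print is 2-D KAM near a Diophantine drift; its 3-D analogue would satisfy this item non-turbulently), Landau-Lifshitz FM sec. 36; HusseinCappGeorge1994 doi:10.1017/s002211209400323x (entrainment constants)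
[crux] r4: BOUNDED-ENERGY FAMILY FOR SOME JET PAIR. There is a jet-pair configuration (rho, a, phi,
f in the class) and a vanishing-viscosity family of global Leray-Hopf solutions driven by f whose
limsup-mean energies are bounded. Card J3 + J5 on T^3: near field - entrainment keeps the jets at
opening angle theta_* with shell energies ~ b 2^(-k) summable down to rho; far field - the two jets
fired at each other (coaxial antipodal a) collide at the antipode, the radial sheet recirculates to
feed entrainment, and with only b and the box size available U_box ~ b^(1/2), energy ~ b. This is
Correlation.BoundedEnergyFamily (stmt-AnomalousDissipation-0203) for an explicit force class and
implies it. Existential in the configuration and the data (laterally offset pairs let each jet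
re-enter its own source and may pump the flux; the prover should use the coaxial geometry). The
witness f must be produced (support JetPairForceExists gives it from any admissible phi). -/
@[route_item "route-AnomalousDissipation-LandauJetArena"]
def JetPairBoundedEnergyFamily : Prop :=
  ∃ (ρ : ℝ) (a : UnitAddTorus (Fin 3)) (φ : UnitAddTorus (Fin 3) → ℝ) (f : UnitAddTorus (Fin 3) → EuclideanSpace ℝ (Fin 3)), (0 < ρ ∧ 4 * ρ < ‖a + a‖ ∧ Literature.Analysis.FunctionSpaces.Torus.IsSmooth φ ∧ (∀ x, 0 ≤ φ x) ∧ (∀ x : UnitAddTorus (Fin 3), ρ ≤ ‖x‖ → φ x = 0) ∧ MeasureTheory.integral MeasureTheory.volume (fun x => φ x) = 1 ∧ Literature.Analysis.FunctionSpaces.Torus.IsSmooth f ∧ Literature.Analysis.FunctionSpaces.Torus.IsDivFree f ∧ Literature.Analysis.FunctionSpaces.Torus.HasZeroMean f ∧ (∀ w : UnitAddTorus (Fin 3) → EuclideanSpace ℝ (Fin 3), Literature.Analysis.FunctionSpaces.Torus.IsSmooth w → Literature.Analysis.FunctionSpaces.Torus.IsDivFree w → MeasureTheory.integral MeasureTheory.volume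 (fun x => inner ℝ (f x) (w x)) = MeasureTheory.integral MeasureTheory.volume (fun x => (φ (x - a) - φ (x + a)) * inner ℝ (w x) (EuclideanSpace.single (2 : Fin 3) (1 : ℝ) : EuclideanSpace ℝ (Fin 3))))) ∧ ∃ (E : ℝ) (ν : ℕ → ℝ) (u₀ : ℕ → UnitAddTorus (Fin 3) → EuclideanSpace ℝ (Fin 3)) (u : ℕ → ℝ → UnitAddTorus (Fin 3) → EuclideanSpace ℝ (Fin 3)), (∀ j, 0 < ν j) ∧ Filter.Tendsto ν Filter.atTop (nhds 0) ∧ (∀ j, Literature.Analysis.FluidPDE.Torus.IsGlobalLerayHopf (ν j) (fun _ => f) (u₀ j) (u j)) ∧ ∀ j, Literature.Analysis.FluidPDE.meanEnergy (u j) ≤ E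

/-- item stmt-AnomalousDissipation-14187 · support · rank 9 · closed · proved by Summit.AnomalousDissipation.AnomalousDissipation.Theorems.CruxesGiveJetPairZerothLaw_proof (prover) · by planner
[support] glue (route-choice (a), 2026-08-16): the crux layer reaches the target BY NAME —
JetPairDissipationFloor → JetPairBoundedEnergyFamily → JetPairZerothLaw. Definitionally equal
(Iff.rfl) to the expanded support item FloorAndFamilyGiveTarget (stmt-AnomalousDissipation-1545);
stated over the route's decl names so that an item visibly concludes the target JetPairZerothLaw
(gate hold route.target-unreachable). Provable NOW by pure logic, ~10 lines, checked rc 0 / 0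
sorries in the planner's Sketch.lean: take (ρ,a,φ,f), E and the family (ν,u₀,u) from r4; r2 at that
configuration and that E gives ε > 0, ν₀ > 0; Tendsto ν atTop (𝓝 0) with eventually_le_nhds hν₀ and
Filter.eventually_atTop gives J with ν j ≤ ν₀ for j ≥ J; reindex j ↦ j+J
(Filter.tendsto_add_atTop_nat J), keep the energy bound E, apply the floor to every reindexed
member. A proof of either this item or stmt-1545 discharges the other by `exact` (candidate proofs
by two refuters are attached as evidence on stmt-1545). With the certified deciding theorem closes :
JetPairZerothLaw → AnomalousDissipation the chain r2, r4 ⇒ X ⇒ Statement is complete (end-to-end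
example checked in Sketch.lean). -/
@[route_item "route-AnomalousDissipation-LandauJetArena"]
def CruxesGiveJetPairZerothLaw : Prop :=
  JetPairDissipationFloor → JetPairBoundedEnergyFamily → JetPairZerothLaw

/-- item stmt-AnomalousDissipation-1545 · support · rank 9 · closed · proved by Summit.AnomalousDissipation.AnomalousDissipation.Theorems.FloorAndFamilyGiveTarget_proof (prover) · by planner
[support] glue, provable now (~40 lines): JetPairDissipationFloor -> JetPairBoundedEnergyFamily ->
JetPairZerothLaw. Take the configuration, E and the family from r4; r2 at that configuration and E
gives eps, nu0; Tendsto nu atTop (nhds 0) gives J with nu j <= nu0 for j >= J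
(Filter.Tendsto.eventually + eventually_atTop); reindex j -> j + J
(Filter.tendsto_add_atTop_iff_nat), keep the energy bound, get eps <= meanDissipation for every
reindexed j. -/
@[route_item "route-AnomalousDissipation-LandauJetArena"]
def FloorAndFamilyGiveTarget : Prop :=
  (∀ (ρ : ℝ) (a : UnitAddTorus (Fin 3)) (φ : UnitAddTorus (Fin 3) → ℝ) (f : UnitAddTorus (Fin 3) → EuclideanSpace ℝ (Fin 3)), (0 < ρ ∧ 4 * ρ < ‖a + a‖ ∧ Literature.Analysis.FunctionSpaces.Torus.IsSmooth φ ∧ (∀ x, 0 ≤ φ x) ∧ (∀ x : UnitAddTorus (Fin 3), ρ ≤ ‖x‖ → φ x = 0) ∧ MeasureTheory.integral MeasureTheory.volume (fun x => φ x) = 1 ∧ Literature.Analysis.FunctionSpaces.Torus.IsSmooth f ∧ Literature.Analysis.FunctionSpaces.Torus.IsDivFree f ∧ Literature.Analysis.FunctionSpaces.Torus.HasZeroMean f ∧ (∀ w : UnitAddTorus (Fin 3) → EuclideanSpace ℝ (Fin 3), Literature.Analysis.FunctionSpaces.Torus.IsSmooth w → Literature.Analysis.FunctionSpaces.Torus.IsDivFree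 w → MeasureTheory.integral MeasureTheory.volume (fun x => inner ℝ (f x) (w x)) = MeasureTheory.integral MeasureTheory.volume (fun x => (φ (x - a) - φ (x + a)) * inner ℝ (w x) (EuclideanSpace.single (2 : Fin 3) (1 : ℝ) : EuclideanSpace ℝ (Fin 3))))) → ∀ E : ℝ, ∃ ε : ℝ, 0 < ε ∧ ∃ ν₀ : ℝ, 0 < ν₀ ∧ ∀ (ν : ℝ) (u₀ : UnitAddTorus (Fin 3) → EuclideanSpace ℝ (Fin 3)) (u : ℝ → UnitAddTorus (Fin 3) → EuclideanSpace ℝ (Fin 3)), 0 < ν → ν ≤ ν₀ → Literature.Analysis.FluidPDE.Torus.IsGlobalLerayHopf ν (fun _ => f) u₀ u → Literature.Analysis.FluidPDE.meanEnergy u ≤ E → ε ≤ Literature.Analysis.FluidPDE.meanDissipation ν u) → (∃ (ρ : ℝ) (a : UnitAddTorus (Fin 3)) (φ : UnitAddTorus (Fin 3) → ℝ) (f : UnitAddTorus (Fin 3) → EuclideanSpace ℝ (Fin 3)), (0 < ρ ∧ 4 * ρ < ‖a + a‖ ∧ Literature.Analysis.FunctionSpaces.Torus.IsSmooth φ ∧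 (∀ x, 0 ≤ φ x) ∧ (∀ x : UnitAddTorus (Fin 3), ρ ≤ ‖x‖ → φ x = 0) ∧ MeasureTheory.integral MeasureTheory.volume (fun x => φ x) = 1 ∧ Literature.Analysis.FunctionSpaces.Torus.IsSmooth f ∧ Literature.Analysis.FunctionSpaces.Torus.IsDivFree f ∧ Literature.Analysis.FunctionSpaces.Torus.HasZeroMean f ∧ (∀ w : UnitAddTorus (Fin 3) → EuclideanSpace ℝ (Fin 3), Literature.Analysis.FunctionSpaces.Torus.IsSmooth w → Literature.Analysis.FunctionSpaces.Torus.IsDivFree w → MeasureTheory.integral MeasureTheory.volume (fun x => inner ℝ (f x) (w x)) = MeasureTheory.integral MeasureTheory.volume (fun x => (φ (x - a) - φ (x + a)) * inner ℝ (w x) (EuclideanSpace.single (2 : Fin 3) (1 : ℝ) : EuclideanSpace ℝ (Fin 3))))) ∧ ∃ (E : ℝ) (ν : ℕ → ℝ) (u₀ : ℕ → UnitAddTorus (Fin 3) → EuclideanSpace ℝ (Fin 3)) (u : ℕ → ℝ → UnitAddTorus (Fin 3) → EuclideanSpace ℝ (Fin 3)), (∀ j, 0 < ν j) ∧ Filter.Tendsto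 ν Filter.atTop (nhds 0) ∧ (∀ j, Literature.Analysis.FluidPDE.Torus.IsGlobalLerayHopf (ν j) (fun _ => f) (u₀ j) (u j)) ∧ ∀ j, Literature.Analysis.FluidPDE.meanEnergy (u j) ≤ E) → (∃ (ρ : ℝ) (a : UnitAddTorus (Fin 3)) (φ : UnitAddTorus (Fin 3) → ℝ) (f : UnitAddTorus (Fin 3) → EuclideanSpace ℝ (Fin 3)), (0 < ρ ∧ 4 * ρ < ‖a + a‖ ∧ Literature.Analysis.FunctionSpaces.Torus.IsSmooth φ ∧ (∀ x, 0 ≤ φ x) ∧ (∀ x : UnitAddTorus (Fin 3), ρ ≤ ‖x‖ → φ x = 0) ∧ MeasureTheory.integral MeasureTheory.volume (fun x => φ x) = 1 ∧ Literature.Analysis.FunctionSpaces.Torus.IsSmooth f ∧ Literature.Analysis.FunctionSpaces.Torus.IsDivFree f ∧ Literature.Analysis.FunctionSpaces.Torus.HasZeroMean f ∧ (∀ w : UnitAddTorus (Fin 3) → EuclideanSpace ℝ (Fin 3), Literature.Analysis.FunctionSpaces.Torus.IsSmooth w → Literature.Analysis.FunctionSpaces.Torus.IsDivFree w → MeasureTheory.integral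 MeasureTheory.volume (fun x => inner ℝ (f x) (w x)) = MeasureTheory.integral MeasureTheory.volume (fun x => (φ (x - a) - φ (x + a)) * inner ℝ (w x) (EuclideanSpace.single (2 : Fin 3) (1 : ℝ) : EuclideanSpace ℝ (Fin 3))))) ∧ ∃ (ν : ℕ → ℝ) (u₀ : ℕ → UnitAddTorus (Fin 3) → EuclideanSpace ℝ (Fin 3)) (u : ℕ → ℝ → UnitAddTorus (Fin 3) → EuclideanSpace ℝ (Fin 3)), (∀ j, 0 < ν j) ∧ Filter.Tendsto ν Filter.atTop (nhds 0) ∧ (∀ j, Literature.Analysis.FluidPDE.Torus.IsGlobalLerayHopf (ν j) (fun _ => f) (u₀ j) (u j)) ∧ (∃ E : ℝ, ∀ j, Literature.Analysis.FluidPDE.meanEnergy (u j) ≤ E) ∧ ∃ ε : ℝ, 0 < ε ∧ ∀ j, ε ≤ Literature.Analysis.FluidPDE.meanDissipation (ν j) (u j))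

/-- item stmt-AnomalousDissipation-1546 · support · rank 9 · closed · proved by Summit.AnomalousDissipation.AnomalousDissipation.Theorems.jetPairForceExists_proof (prover) · by planner
sources: Literature/Analysis/FluidPDE/LerayProjector.lean: Torus.lerayProjector, Torus.mFourierCoeff_lerayProjector, Torus.lerayProjector_eq_self_of_mem, ConstantinFoias1988 (4.38)-(4.40) (torus Leray projector as a Fourier multiplier)
[support] nonemptiness of the jet-pair class, provable now (torus Fourier series; moderate): for
every admissible (rho, a, phi) there is f with JetPair(rho,a,phi,f), namely f = P g, g = (phi(.-a) -
phi(.+a)) e3: g is smooth (IsSmooth.comp_add_right, .sub, .smul), its Fourier coefficients decay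
rapidly, the Leray multiplier I - k(x)k/|k|^2 (Torus.lerayCoeff,
Literature.Analysis.FluidPDE.Torus.mFourierCoeff_lerayProjector) is bounded so P g has rapidly
decaying coefficients hence is smooth; div-free and mean-zero by the multiplier (lerayCoeff 0 = 0);
the orthogonality clause is Parseval against smooth div-free w (w-hat(k) orthogonal to k). Serves r4
and the target. -/
@[route_item "route-AnomalousDissipation-LandauJetArena"]
def JetPairForceExists : Prop :=
  ∀ (ρ : ℝ) (a : UnitAddTorus (Fin 3)) (φ : UnitAddTorus (Fin 3) → ℝ), 0 < ρ → 4 * ρ < ‖a + a‖ → Literature.Analysis.FunctionSpaces.Torus.IsSmooth φ → (∀ x, 0 ≤ φ x) → (∀ x : UnitAddTorus (Fin 3), ρ ≤ ‖x‖ → φ x = 0) → MeasureTheory.integral MeasureTheory.volume (fun x => φ x) = 1 → ∃ f : UnitAddTorus (Fin 3) → EuclideanSpace ℝ (Fin 3), (0 < ρ ∧ 4 * ρ < ‖a + a‖ ∧ Literature.Analysis.FunctionSpaces.Torus.IsSmooth φ ∧ (∀ x, 0 ≤ φ x) ∧ (∀ x : UnitAddTorus (Fin 3), ρ ≤ ‖x‖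 → φ x = 0) ∧ MeasureTheory.integral MeasureTheory.volume (fun x => φ x) = 1 ∧ Literature.Analysis.FunctionSpaces.Torus.IsSmooth f ∧ Literature.Analysis.FunctionSpaces.Torus.IsDivFree f ∧ Literature.Analysis.FunctionSpaces.Torus.HasZeroMean f ∧ (∀ w : UnitAddTorus (Fin 3) → EuclideanSpace ℝ (Fin 3), Literature.Analysis.FunctionSpaces.Torus.IsSmooth w → Literature.Analysis.FunctionSpaces.Torus.IsDivFree w → MeasureTheory.integral MeasureTheory.volume (fun x => inner ℝ (f x) (w x)) = MeasureTheory.integral MeasureTheory.volume (fun x => (φ (x - a) - φ (x + a)) * inner ℝ (w x) (EuclideanSpace.single (2 : Fin 3) (1 : ℝ) : EuclideanSpace ℝ (Fin 3)))))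

/-- item stmt-AnomalousDissipation-1547 · support · rank 9 · open · by planner
why it might fail: C^0 (non-C^1) cones might come from stationary convex integration (Choffrut-Szekelyhidi-type bounded weak solutions) and need not obey Shvydkoy's integral identities (no local energy/flux balance below Onsager regularity); a flux-carrying continuous cone refutes it and redirects r2's engine.
sources: Shvydkoy2018 = arXiv:1510.03378 p.3 (summary), Prop. 2.1 p.5 ('There are no C^1-solutions to the system for alpha = 1'), sec. 5.1 p.12 (singular axisymmetric family; relation to Landau), LuoShvydkoy2015 = arXiv:1409.4322 (2-D homogeneous classification), Abe2024 = arXiv:2305.05987 (existence of homogeneous Euler flows only for degrees outside [-2,0]), ChoffrutSzekelyhidi2014 (weak stationary Euler solutions by convex integration; why C^0 might fail)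
[support] arena rigidity (E), the engine behind r2's intended proof and r3's floor; 'adapt Shvydkoy
2018 sec. 2': a steady weak Euler cone carries NO MOMENTUM FLUX. Let U : R^3 -> R^3, P : R^3 -> R be
continuous on R^3 minus 0, homogeneous of degrees -1 and -2, weakly divergence-free and a weak
steady Euler pair away from the origin (tests supported off 0: int <U, (grad Phi) U> + P div Phi =
0). Then for every smooth radial cut-off chi(|x|) (chi = 1 on r <= 1, 0 on r >= 2) the momentum-flux
vector int [<U, grad chi> U + P grad chi] dx vanishes - i.e. the r-independent flux int_{S^2} (U_r U
+ P n) d sigma is 0, so no such cone can absorb the jet's unit flux e3. For C^1 profiles this is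
contained in Shvydkoy's Prop. 2.1 (no nonzero C^1 solutions at alpha = 1; independently Luo-Xin per
his footnote); the item asks for C^0 profiles (first rung towards L^2(S^2)/statistical cones). Known
singular cones (Shvydkoy sec. 5.1: axisymmetric swirl-free psi^2 = Ax^2+Bx+C) blow up on the axis
like 1/(r sin phi), are not C^0 on R^3 minus 0 and have log-divergent shell energy. -/
@[route_item "route-AnomalousDissipation-LandauJetArena"]
def NoConicalEulerFlux : Prop :=
  ∀ (U : EuclideanSpace ℝ (Fin 3) → EuclideanSpace ℝ (Fin 3)) (P : EuclideanSpace ℝ (Fin 3) → ℝ), ContinuousOn U {x | x ≠ 0} → ContinuousOn P {x | x ≠ 0} → (∀ (c : ℝ) (x : EuclideanSpace ℝ (Fin 3)), 0 < c → U (c • x) = c⁻¹ • U x) → (∀ (c : ℝ) (x : EuclideanSpace ℝ (Fin 3)), 0 < c → P (c • x) = (c ^ 2)⁻¹ * P x) → (∀ θ : EuclideanSpace ℝ (Fin 3) → ℝ, ContDiff ℝ (⊤ : ℕ∞) θ → HasCompactSupport θ → (0 : EuclideanSpace ℝ (Fin 3)) ∉ tsupport θ → MeasureTheory.integral MeasureTheory.volume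 (fun x => inner ℝ (U x) (gradient θ x)) = 0) → (∀ Φ : EuclideanSpace ℝ (Fin 3) → EuclideanSpace ℝ (Fin 3), ContDiff ℝ (⊤ : ℕ∞) Φ → HasCompactSupport Φ → (0 : EuclideanSpace ℝ (Fin 3)) ∉ tsupport Φ → MeasureTheory.integral MeasureTheory.volume (fun x => inner ℝ (U x) (fderiv ℝ Φ x (U x)) + P x * Literature.Analysis.FluidPDE.VectorCalculus.divergence Φ x) = 0) → ∀ χ : ℝ → ℝ, ContDiff ℝ (⊤ : ℕ∞) χ → (∀ r, r ≤ 1 → χ r = 1) → (∀ r, 2 ≤ r → χ r = 0) → MeasureTheory.integral MeasureTheory.volume (fun x => inner ℝ (U x) (gradient (fun y : EuclideanSpace ℝ (Fin 3) => χ ‖y‖) x) • U x + P x • gradient (fun y : EuclideanSpace ℝ (Fin 3) => χ ‖y‖) x) = 0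

/-- item stmt-AnomalousDissipation-1548 · support · rank 9 · closed · proved by Summit.AnomalousDissipation.AnomalousDissipation.Theorems.LandauOverDissipation.landauOverDissipation_proof @ a5885b7f1075 (prover) · by planner
sources: KarchPilarczyk2011 = arXiv:1104.3589 p.3 (2.1)-(2.2): explicit v_c, p_c, b(c), b -> infinity as c -> 1, Batchelor 1967 sec. 4.6 eq. (4.6.8); Landau-Lifshitz FM sec. 23, Sverak2011 = arXiv:math/0604550 (the family exhausts smooth (-1)-homogeneous steady NS)
[support] fact (L) made quantitative, provable now by explicit real analysis (card J1): for the
Landau family v_c (nu = 1, axis e1, Karch-Pilarczyk (2.1); force b(c) delta_0 e1 with b(c) = 8 pi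
c/(3(c^2-1)) (2 + 6c^2 - 3c(c^2-1) log((c+1)/(c-1))) -> +infinity as c -> 1+) there are C1 > 0, C2
with, for all c in (1,2): shell energy int_A |v_c|^2 <= C2 b(c) and shell dissipation int_A |grad
v_c|_F^2 >= C1 b(c)^2 on A = {1<|x|<2}. Planner's asymptotics (eps = c-1, s = theta^2/2): v^1 ~ 4
eps/(r (eps+s)^2), int_A|v_c|^2 ~ 32 pi/(3 eps) ~ b(c), int_A |grad v_c|^2 ~ const/eps^2 ~ b(c)^2.
Dictionary to fixed force B at viscosity nu: U_{B,nu} = nu v_c with nu^2 b(c) = B, so E_A(U) = nu^2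
int_A|v_c|^2 ~ B (BOUNDED) while D_A(U) = nu^3 int_A|grad v_c|^2 ~ B^2/nu = B^(3/2) Re -> infinity:
the laminar state satisfies the energy clause and violates the zeroth law UPWARD (D_A/B^(3/2) ~ Re),
the reverse of every T^3 laminar example (energy ~ nu^-2). A refutation would mean the planner's
scaling is wrong and would re-rank r3's ceiling. -/
@[route_item "route-AnomalousDissipation-LandauJetArena"]
def LandauOverDissipation : Prop :=
  ∃ C₁ C₂ : ℝ, 0 < C₁ ∧ ∀ c : ℝ, 1 < c → c < 2 → MeasureTheory.integral (MeasureTheory.volume.restrict {x : EuclideanSpace ℝ (Fin 3) | 1 < ‖x‖ ∧ ‖x‖ < 2}) (fun x => ‖(fun (c : ℝ) (x : EuclideanSpace ℝ (Fin 3)) => !₂[2 * (c * ‖x‖ ^ 2 - 2 * x 0 * ‖x‖ + c * x 0 ^ 2) / (‖x‖ * (c * ‖x‖ - x 0) ^ 2), 2 * (x 1 * (c * x 0 - ‖x‖)) / (‖x‖ * (c * ‖x‖ - x 0) ^ 2), 2 * (x 2 * (c * x 0 - ‖x‖)) / (‖x‖ * (c * ‖x‖ - x 0) ^ 2)]) c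 x‖ ^ 2) ≤ C₂ * (fun c : ℝ => 8 * Real.pi * c / (3 * (c ^ 2 - 1)) * (2 + 6 * c ^ 2 - 3 * c * (c ^ 2 - 1) * Real.log ((c + 1) / (c - 1)))) c ∧ C₁ * ((fun c : ℝ => 8 * Real.pi * c / (3 * (c ^ 2 - 1)) * (2 + 6 * c ^ 2 - 3 * c * (c ^ 2 - 1) * Real.log ((c + 1) / (c - 1)))) c) ^ 2 ≤ MeasureTheory.integral (MeasureTheory.volume.restrict {x : EuclideanSpace ℝ (Fin 3) | 1 < ‖x‖ ∧ ‖x‖ < 2}) (fun x => Literature.Analysis.FluidPDE.frobeniusNormSq (fderiv ℝ ((fun (c : ℝ) (x : EuclideanSpace ℝ (Fin 3)) => !₂[2 * (c * ‖x‖ ^ 2 - 2 * x 0 * ‖x‖ + c * x 0 ^ 2) / (‖x‖ * (c * ‖x‖ - x 0) ^ 2), 2 * (x 1 * (c * x 0 - ‖x‖)) / (‖x‖ * (c * ‖x‖ - x 0) ^ 2), 2 * (x 2 * (c * x 0 - ‖x‖)) / (‖x‖ * (c * ‖x‖ - x 0) ^ 2)]) c) x))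

/-- item stmt-AnomalousDissipation-1541 · assembly · rank 1 · closed · proved by Summit.AnomalousDissipation.AnomalousDissipation.Theorems.landauJetArena_assembly_proof (prover) · by planner
[assembly] X -> AnomalousDissipation: unpack X, discard the jet-pair clauses except IsSmooth f,
IsDivFree f, HasZeroMean f, repack. Term-mode proof (4 lines: obtain/obtain/exact) checked rc 0 in
the planner's Sketch.lean; AnomalousDissipation unfolds to Literature.Turb.ZerothLaw by `exact` with
the anonymous constructor. -/
@[route_item "route-AnomalousDissipation-LandauJetArena"]
def Assembly : Prop :=
  (∃ (ρ : ℝ) (a : UnitAddTorus (Fin 3)) (φ : UnitAddTorus (Fin 3) → ℝ) (f : UnitAddTorus (Fin 3) → EuclideanSpace ℝ (Fin 3)), (0 < ρ ∧ 4 * ρ < ‖a + a‖ ∧ Literature.Analysis.FunctionSpaces.Torus.IsSmooth φ ∧ (∀ x, 0 ≤ φ x) ∧ (∀ x : UnitAddTorus (Fin 3), ρ ≤ ‖x‖ → φ x = 0) ∧ MeasureTheory.integral MeasureTheory.volume (fun x => φ x) = 1 ∧ Literature.Analysis.FunctionSpaces.Torus.IsSmooth f ∧ Literature.Analysis.FunctionSpaces.Torus.IsDivFree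 f ∧ Literature.Analysis.FunctionSpaces.Torus.HasZeroMean f ∧ (∀ w : UnitAddTorus (Fin 3) → EuclideanSpace ℝ (Fin 3), Literature.Analysis.FunctionSpaces.Torus.IsSmooth w → Literature.Analysis.FunctionSpaces.Torus.IsDivFree w → MeasureTheory.integral MeasureTheory.volume (fun x => inner ℝ (f x) (w x)) = MeasureTheory.integral MeasureTheory.volume (fun x => (φ (x - a) - φ (x + a)) * inner ℝ (w x) (EuclideanSpace.single (2 : Fin 3) (1 : ℝ) : EuclideanSpace ℝ (Fin 3))))) ∧ ∃ (ν : ℕ → ℝ) (u₀ : ℕ → UnitAddTorus (Fin 3) → EuclideanSpace ℝ (Fin 3)) (u : ℕ → ℝ → UnitAddTorus (Fin 3) → EuclideanSpace ℝ (Fin 3)), (∀ j, 0 < ν j) ∧ Filter.Tendsto ν Filter.atTop (nhds 0) ∧ (∀ j, Literature.Analysis.FluidPDE.Torus.IsGlobalLerayHopf (ν j) (fun _ => f) (u₀ j) (u j)) ∧ (∃ E : ℝ, ∀ j, Literature.Analysis.FluidPDE.meanEnergy (u j) ≤ E) ∧ ∃ ε : ℝ, 0 < ε ∧ ∀ j,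 ε ≤ Literature.Analysis.FluidPDE.meanDissipation (ν j) (u j)) → AnomalousDissipation

/-! D-0027 §2.1 — DECIDING THEOREM (planner-authored via `route open/edit --closes-file`; by planner-rbadge-AnomalousDissipation-LandauJetA-4ac1e2a2-g2-0 2026-08-15T16:12:59Z):
its hypotheses are this route's items and its conclusion the sub-problem Statement (glue_lint), and it elaborates with this file. -/

@[closes "route-AnomalousDissipation-LandauJetArena"] theorem closes (hX : JetPairZerothLaw) : _root_.AnomalousDissipation := by
  -- Frame #1 of the thesis, PROVED (not assumed): X = JetPairZerothLaw (the zeroth law restricted to push–pull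
  -- jet-pair forces) → AnomalousDissipation, by forgetting the jet-pair clauses except IsSmooth f, IsDivFree f,
  -- HasZeroMean f. The crux layer feeds X through the support item FloorAndFamilyGiveTarget
  -- (JetPairDissipationFloor → JetPairBoundedEnergyFamily → JetPairZerothLaw: reindex the bounded-energy family past
  -- ν₀(E) and apply the floor), so the deciding theorem stays certified under any crux-level restatement.
  obtain ⟨ρ, a, φ, f, ⟨-, -, -, -, -, -, hfs, hfd, hfm, -⟩, ν, u₀, u, hν, hT, hLH, hE, ε, hε, hD⟩ := hX
  show Literature.Turb.ZerothLaw
  exact ⟨f, hfs, hfd, hfm, ν, u₀, u, hν, hT, hLH, hE, ε, hε, hD⟩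

end Summit.AnomalousDissipation.AnomalousDissipation.Theses.LandauJetArena
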